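import Literature.MathematicalPhysics.QuantumFieldTheory.QCDTransferMatrix

/-!
# Positivity of the dressed core `M′ = (1 + P⁺CP⁻)(B P⁺ + B⁻¹P⁻)(1 − P⁻CP⁺)`
(helper for crux stmt-QuantumFields-9737 `QuarksAsStableAction.StableActionBridge`, line `Sketch` —
stub `dressedCore_posDef`)

In Lüscher's transfer-matrix form of the time-slice reduction of the Wilson fermion determinant
(Lüscher, CMP 54 (1977); Smit, *Introduction to Quantum Fields on a Lattice*, §6.5 (6.91), with the
roles of `P±` exchanged) the one-step matrix is `−E_t⁻¹F_t = (W P⁺ + P⁻)·M′_t·(P⁺ + W P⁻)` with the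
*dressed core*
`M′ = (1 + P⁺ C P⁻)(B P⁺ + B⁻¹ P⁻)(1 − P⁻ C P⁺)`.
Here `P± = Pp, Pm` are complementary Hermitian projections (`P⁺ + P⁻ = 1`, `P±² = P±`,
`P⁺P⁻ = 0 = P⁻P⁺`), `B` is the positive definite spin-blind part (commuting with `P±`) and `C` is
the anti-Hermitian off-diagonal part.  This file proves: `M′` is Hermitian positive definite.

Proof (congruence).  With `Y := 1 + P⁺ C P⁻` and `K := B P⁺ + B⁻¹ P⁻` one has `M′ = Y K Yᴴ`, since
`Yᴴ = 1 + P⁻ Cᴴ P⁺ = 1 − P⁻ C P⁺`; `Y` is a unit because `(P⁺ C P⁻)² = P⁺ C (P⁻P⁺) C P⁻ = 0` is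
nilpotent (`IsNilpotent.isUnit_one_add`); and `K` is positive definite: it is positive semidefinite
as the sum of `B P⁺ = P⁺ B P⁺ = P⁺ᴴ B P⁺` and `B⁻¹ P⁻ = P⁻ᴴ B⁻¹ P⁻`
(`Matrix.PosSemidef.conjTranspose_mul_mul_same`), and invertible with the explicit inverse
`P⁺ B⁻¹ + P⁻ B` (`Matrix.PosSemidef.posDef_iff_isUnit`).  Finally positive definiteness is invariant
under congruence by a unit (`Matrix.IsUnit.posDef_star_right_conjugate_iff`).  Pure theorem file
(no definitions), pure Mathlib matrix algebra.
-/

namespace Summit.QuantumFields.QCD.Cruxes.StableActionBridge.Sketch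

open scoped ComplexOrder
open Literature.MathematicalPhysics.QuantumFieldTheory Literature.MathematicalPhysics.QuantumLattice

namespace DressedCorePosDef

open Matrix

variable {n : Type*} [Fintype n]

/-- Reassociation `X P (Q Z) = X (P Q) Z`, exposing the inner product `P Q`. -/
theorem reassoc₄ (X P Q Z : Matrix n n ℂ) : X * P * (Q * Z) = X * (P * Q) * Z := by
  simp only [Matrix.mul_assoc]

/-- `B P` is positive semidefinite for positive semidefinite `B` commuting with the Hermitian
idempotent `P`: indeed `B P = P B P = Pᴴ B P`. -/
theorem posSemidef_mul_proj {B P : Matrix n n ℂ} (hB : B.PosSemidef) (hP2 : P * P = P)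
    (hPH : P.IsHermitian) (hBP : B * P = P * B) : (B * P).PosSemidef := by
  have h := hB.conjTranspose_mul_mul_same P
  rwa [hPH.eq, ← hBP, mul_assoc, hP2] at h

variable [DecidableEq n]

/-- The inverse of an invertible matrix commutes with whatever the matrix commutes with. -/
theorem inv_mul_comm_of_mul_comm {B P : Matrix n n ℂ} (hB : IsUnit B.det) (h : B * P = P * B) :
    B⁻¹ * P = P * B⁻¹ := by
  calc B⁻¹ * P = B⁻¹ * P * (B * B⁻¹) := by rw [mul_nonsing_inv _ hB, mul_one]
    _ = B⁻¹ * (P * B) * B⁻¹ := by simp only [Matrix.mul_assoc]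
    _ = B⁻¹ * (B * P) * B⁻¹ := by rw [h]
    _ = P * B⁻¹ := by rw [← mul_assoc, nonsing_inv_mul _ hB, one_mul]

/-- The kernel `K = B P⁺ + B⁻¹ P⁻` has the explicit right inverse `P⁺ B⁻¹ + P⁻ B`. -/
theorem kernel_mul_explicitInv {Pp Pm B : Matrix n n ℂ} (hB : IsUnit B.det) (hsum : Pp + Pm = 1)
    (hPp2 : Pp * Pp = Pp) (hPm2 : Pm * Pm = Pm) (hPpPm : Pp * Pm = 0) (hPmPp : Pm * Pp = 0)
    (hBPp : B * Pp = Pp * B) (hBPm : B * Pm = Pm * B) :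
    (B * Pp + B⁻¹ * Pm) * (Pp * B⁻¹ + Pm * B) = 1 := by
  rw [add_mul, mul_add, mul_add, reassoc₄, reassoc₄, reassoc₄, reassoc₄, hPp2, hPpPm, hPmPp, hPm2]
  simp only [mul_zero, zero_mul, add_zero, zero_add]
  rw [hBPp, mul_assoc Pp B B⁻¹, mul_nonsing_inv _ hB, mul_one, mul_assoc B⁻¹ Pm B, ← hBPm,
    ← mul_assoc B⁻¹ B Pm, nonsing_inv_mul _ hB, one_mul, hsum]

/-- **Positivity of the kernel**: `K = B P⁺ + B⁻¹ P⁻` is positive definite for positive definite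
`B` commuting with the complementary Hermitian projections `P±`. -/
theorem kernel_posDef {Pp Pm B : Matrix n n ℂ} (hsum : Pp + Pm = 1)
    (hPp2 : Pp * Pp = Pp) (hPm2 : Pm * Pm = Pm) (hPpPm : Pp * Pm = 0) (hPmPp : Pm * Pp = 0)
    (hPpH : Pp.IsHermitian) (hPmH : Pm.IsHermitian)
    (hBPp : B * Pp = Pp * B) (hBPm : B * Pm = Pm * B) (hB : B.PosDef) :
    (B * Pp + B⁻¹ * Pm).PosDef := by
  have hdet : IsUnit B.det := (isUnit_iff_isUnit_det B).mp hB.isUnit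
  have hpsd : (B * Pp + B⁻¹ * Pm).PosSemidef :=
    (posSemidef_mul_proj hB.posSemidef hPp2 hPpH hBPp).add
      (posSemidef_mul_proj hB.inv.posSemidef hPm2 hPmH (inv_mul_comm_of_mul_comm hdet hBPm))
  exact hpsd.posDef_iff_isUnit.mpr
    (IsUnit.of_mul_eq_one _ (kernel_mul_explicitInv hdet hsum hPp2 hPm2 hPpPm hPmPp hBPp hBPm))

/-- The dressing `Y = 1 + P⁺ C P⁻` has adjoint `Yᴴ = 1 − P⁻ C P⁺` for anti-Hermitian `C`. -/
theorem star_dressing {Pp Pm C : Matrix n n ℂ} (hPpH : Pp.IsHermitian) (hPmH : Pm.IsHermitian)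
    (hC : Cᴴ = -C) : star (1 + Pp * C * Pm) = 1 - Pm * C * Pp := by
  rw [star_eq_conjTranspose, conjTranspose_add, conjTranspose_one, conjTranspose_mul,
    conjTranspose_mul, hPpH.eq, hPmH.eq, hC, neg_mul, mul_neg, ← mul_assoc, ← sub_eq_add_neg]

/-- The dressing `Y = 1 + P⁺ C P⁻` is a unit: `(P⁺ C P⁻)² = P⁺ C (P⁻ P⁺) C P⁻ = 0`. -/
theorem isUnit_dressing {Pp Pm : Matrix n n ℂ} (C : Matrix n n ℂ) (hPmPp : Pm * Pp = 0) :
    IsUnit (1 + Pp * C * Pm) := by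
  refine IsNilpotent.isUnit_one_add ⟨2, ?_⟩
  have h : Pp * C * Pm * (Pp * C * Pm) = Pp * C * (Pm * Pp) * C * Pm := by
    simp only [Matrix.mul_assoc]
  rw [pow_two, h, hPmPp, mul_zero, zero_mul, zero_mul]

end DressedCorePosDef

/-- **Positivity of the dressed core** (Lüscher 1977; Smit, *Introduction to Quantum Fields on a
Lattice*, §6.5 (6.91), roles of `P±` exchanged): for complementary Hermitian projections
`P⁺ + P⁻ = 1`, a positive definite `B` commuting with `P±` and an anti-Hermitian `C`, the core
`M′ = (1 + P⁺ C P⁻)(B P⁺ + B⁻¹ P⁻)(1 − P⁻ C P⁺)` of the one-step fermionic transfer matrix is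
positive definite — it is the congruence `Y (B P⁺ + B⁻¹ P⁻) Yᴴ` by the unit `Y = 1 + P⁺ C P⁻`. -/
theorem dressedCore_posDef :
    ∀ (n : Type) [Fintype n] [DecidableEq n] (Pp Pm Bh C : Matrix n n ℂ),
      Pp + Pm = 1 → Pp * Pp = Pp → Pm * Pm = Pm → Pp * Pm = 0 → Pm * Pp = 0 →
      Pp.IsHermitian → Pm.IsHermitian → Bh * Pp = Pp * Bh → Bh * Pm = Pm * Bh → C.conjTranspose = -C →
      Bh.PosDef → ((1 + Pp * C * Pm) * (Bh * Pp + Bh⁻¹ * Pm) * (1 - Pm * C * Pp)).PosDef := by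
  intro n _ _ Pp Pm Bh C hsum hPp2 hPm2 hPpPm hPmPp hPpH hPmH hBPp hBPm hC hBh
  rw [← DressedCorePosDef.star_dressing hPpH hPmH hC]
  exact (Matrix.IsUnit.posDef_star_right_conjugate_iff
      (DressedCorePosDef.isUnit_dressing C hPmPp)).mpr
    (DressedCorePosDef.kernel_posDef hsum hPp2 hPm2 hPpPm hPmPp hPpH hPmH hBPp hBPm hBh)

end Summit.QuantumFields.QCD.Cruxes.StableActionBridge.Sketch
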